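import Literature.NumberTheory.EllipticCurves.ModularFormsLevelRank
import Literature.NumberTheory.EllipticCurves.ModularFormsGamma1ExplicitForms
import Literature.NumberTheory.EllipticCurves.ModularFormsGamma1PlusMinus
import HarnessLib

/-!
# The rank input for `±Γ₁(N)`: the conjugate matrix of the forms `E_4^χ Δ^{μ-1-i}Δ_N^i` is
# invertible; hence `M(±Γ₁(N)) = ⊕_{k even} M_k(Γ₁(N))` is free of rank `φ(N)μ/2` over `ℂ[E₄, E₆]`
# on generators satisfying Gannon's constraints with `ν₂ = ν₃ = 0`

`ModularFormsLevelRank` reduces the structure of `M(Γ) = ⊕ₖ M_k(Γ)` over `R = ℂ[E₄, E₆]` for a level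
`Γ ∋ T, -1` of finite index — rank `[SL₂(ℤ) : Γ]`, `𝒟¹² = cΔ^K`, the constraints modulo `4` and
`6` — to a `Level.RankInput Γ`: `[SL₂(ℤ) : Γ]` forms of a common weight whose conjugate matrix over
`SL₂(ℤ)/Γ` is invertible at some point. This file supplies it for **`Γ = ±Γ₁(N)`**, `N ≥ 3`
(`Gamma1pm N = adjoinNegI (Gamma1 N)` of `ModularFormsGamma1PlusMinus`), from the family
`G_{χ,i} = E_4^χ Δ^{μ-1-i}Δ_N^i` (`χ` even, `i < μ = [SL₂(ℤ) : Γ₀(N)]`) of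
`ModularFormsGamma1ExplicitForms`:

* `charExplicitForm_conj_indep` — **the conjugates separate the family**: if
  `∑_{χ,i} c_{χ,i} (G_{χ,i} ∣ h)(τ) = 0` for every `h ∈ SL₂(ℤ)`, at a point `τ` where the `μ`
  conjugates of `Δ_N` take distinct values and the conjugates `E_4^χ ∣ g_b` of the Eisenstein
  factors through the (inverse) representatives `g_b` of `SL₂(ℤ)/Γ₀(N)` do not vanish, then `c = 0`.
  Proof: `h = σ_d β` with `σ_d ∈ Γ₀(N)` of lower-right entry `d` turns the relation into
  `∑_{χ,i} c_{χ,i} χ(d) (E_4^χ ∣ β)(τ) (G_i ∣ β)(τ) = 0` for all units `d`; orthogonality of the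
  characters of `(ℤ/N)ˣ` isolates each `χ`, the non-zero scalar `(E_4^χ ∣ β)(τ)` cancels, and the
  `Γ₀(N)`-conjugate matrix of the `G_i` at `τ` (a scaled Vandermonde in the conjugates of `Δ_N`, as in
  `explicitForm_indep`) is invertible — the determinant is "(character table) `⊗` (Vandermonde)"
  without writing a Kronecker product.
* `exists_good_point` — such a point exists (finitely many non-zero holomorphic functions have a
  common non-zero, `prod_ne_zero_of_mdifferentiable`).
* **`rankInputGamma1pm N hN : Level.RankInput (Gamma1pm N)`** (`N ≥ 3`): the family reindexed by
  `Fin [SL₂(ℤ) : ±Γ₁(N)] ≃ EvenCharIndex N` (`2[SL₂(ℤ) : ±Γ₁(N)] = φ(N)μ = 2#EvenCharIndex`); the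
  relation on all cosets of `±Γ₁(N)` is the relation for all `h` (`Level.cosetSlash_mk`).
* Consequences read off `ModularFormsLevelRank`: **`exists_isLevelBasis_gamma1pm`** — a level-one
  basis of `M(±Γ₁(N))` indexed by `Fin [SL₂(ℤ) : ±Γ₁(N)]`, of even weights `≥ 0` — and, for
  `N ≥ 4` (no elliptic points, `ModularFormsGamma1PlusMinus`), **`card_constraints_gamma1pm`**:
  `2#{4 ∣ k_j} = [SL₂(ℤ):±Γ₁(N)] = 2#{4 ∤ k_j}`,
  `3#{6 ∣ k_j} = 3#{k_j ≡ 2 (6)} = 3#{k_j ≡ 4 (6)} = [SL₂(ℤ):±Γ₁(N)]`.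

What remains for the dimension of `M_k(Γ₁(N))` in large even weight is the cusp constraint
`∑ k_j = 6([SL₂(ℤ):±Γ₁(N)] - ε_∞)` (model: `ModularFormsGamma0Genus`) and the bookkeeping of
`ModularFormsGamma0Dimension`. Everything here is proved; no named facts.

## References

* T. Gannon, *The theory of vector-valued modular forms for the modular group*, Contrib. Math.
  Comput. Sci. 8 (2014), 247–286, Thm. 3.4, §3.5.
* F. Diamond, J. Shurman, *A first course in modular forms*, GTM 228 (2005), §3.9 (dimension
  formulas for `Γ₁(N)`, even weight), §4.3.
-/

noncomputable section

open UpperHalfPlane hiding I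
open ModularForm Complex Matrix.SpecialLinearGroup Filter CongruenceSubgroup
open scoped MatrixGroups ModularForm Topology Manifold

namespace Literature.NumberTheory.EllipticCurves.ModularForms

section ConjIndep

variable {N : ℕ} [NeZero N]

/-- The weight `w₀ = 4 + 12(μ - 1)` of the forms `G_{χ,i}`. [folklore] -/
abbrev charExplicitWeight (N : ℕ) : ℤ := 4 + 12 * ((gamma0Index N : ℤ) - 1)

/-- `G_{χ,i} ∣ (σβ) = χ(d) · (E_4^χ ∣ β) · (G_i ∣ β)` for `σ ∈ Γ₀(N)` with lower-right entry `d`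
(nebentypus of `E_4^χ`, `Γ₀(N)`-invariance of `G_i`, multiplicativity of the slash in the weight).
[folklore] -/
theorem charExplicitForm_slash_mul (χ : DirichletCharacter ℂ N) (i : Fin (gamma0Index N))
    {σ : SL(2, ℤ)} (hσ : σ ∈ Gamma0 N) (β : SL(2, ℤ)) :
    charExplicitForm N χ i ∣[charExplicitWeight N] (σ * β) =
      χ ((σ 1 1 : ℤ) : ZMod N) •
        (eisensteinChar N 4 χ ∣[(4 : ℤ)] β *
          explicitForm N (gamma0Index N) i ∣[12 * ((gamma0Index N : ℤ) - 1)] β) := by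
  have hG := slash_eq_of_mem_gamma0Space (explicitForm_mem N (gamma0Index N) i)
  have hG' : explicitForm N (gamma0Index N) i ∣[12 * ((gamma0Index N : ℤ) - 1)] σ =
      explicitForm N (gamma0Index N) i := by
    rw [ModularForm.SL_slash]
    exact hG σ hσ
  rw [charExplicitForm, SlashAction.slash_mul, ModularForm.mul_slash_SL2,
    eisensteinChar_slash_of_mem_gamma0 hσ, hG', smul_mul_assoc, ModularForm.SL_smul_slash,
    ModularForm.mul_slash_SL2]

/-- The (inverse) coset representatives `g_b = (x_b.out)⁻¹` of `SL₂(ℤ)/Γ₀(N)`, `b < μ`, through the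
enumeration `cosetEquiv N` of `ModularFormsGamma0Rank`. [folklore] -/
def gamma0Rep (N : ℕ) [NeZero N] (b : Fin (gamma0Index N)) : SL(2, ℤ) :=
  (((cosetEquiv N).symm b).out)⁻¹

/-- The conjugate of `G_i` by `g_b` at `τ` is `Δ(τ)^{μ-1} u_b(τ)^i`, `u_b = (Δ_N ∣ g_b)/Δ`. [folklore] -/
theorem explicitForm_slash_gamma0Rep_apply (i b : Fin (gamma0Index N)) (τ : ℍ) :
    (explicitForm N (gamma0Index N) i ∣[12 * ((gamma0Index N : ℤ) - 1)] gamma0Rep N b) τ =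
      ModularForm.discriminant τ ^ ((gamma0Index N) - 1) *
        (conjDeltaDil N ((cosetEquiv N).symm b) τ / ModularForm.discriminant τ) ^ (i : ℕ) := by
  have hΔ : ModularForm.discriminant τ ≠ 0 := discriminant_ne_zero τ
  have hi : (i : ℕ) ≤ (gamma0Index N) - 1 := Nat.le_sub_one_of_lt i.2
  have hsl : (explicitForm N (gamma0Index N) i ∣[12 * ((gamma0Index N : ℤ) - 1)] gamma0Rep N b) τ =
      conjDeltaDil N ((cosetEquiv N).symm b) τ ^ (i : ℕ) *
        ModularForm.discriminant τ ^ ((gamma0Index N) - 1 - (i : ℕ)) := by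
    rw [show 12 * (((gamma0Index N) : ℤ) - 1) =
        (((gamma0Index N) - 1 - (i : ℕ) : ℕ) : ℤ) * 12 + ((i : ℕ) : ℤ) * 12 by
      rw [Nat.cast_sub hi, Nat.cast_sub (by omega)]; ring, explicitForm, gamma0Rep,
      ModularForm.mul_slash_SL2, pow_slash_SL2, pow_slash_SL2, ModularForm.SL_slash, discriminant_slash,
      ModularForm.SL_slash]
    rw [Pi.mul_apply, Pi.pow_apply, Pi.pow_apply, mul_comm]
    rfl
  rw [hsl]
  have hsplit : ModularForm.discriminant τ ^ ((gamma0Index N) - 1) =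
      ModularForm.discriminant τ ^ ((gamma0Index N) - 1 - (i : ℕ)) * ModularForm.discriminant τ ^ (i : ℕ) := by
    rw [← pow_add, Nat.sub_add_cancel hi]
  rw [hsplit, div_pow, div_eq_mul_inv]
  have hu : ModularForm.discriminant τ ^ (i : ℕ) * (ModularForm.discriminant τ ^ (i : ℕ))⁻¹ = 1 :=
    mul_inv_cancel₀ (pow_ne_zero _ hΔ)
  linear_combination (-(conjDeltaDil N ((cosetEquiv N).symm b) τ ^ (i : ℕ) *
    ModularForm.discriminant τ ^ ((gamma0Index N) - 1 - (i : ℕ)))) * hu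

/-- **The conjugates separate the family `G_{χ,i}`**: if `∑_{χ ∈ s} ∑_i c_{χ,i} (G_{χ,i} ∣ h)(τ) = 0`
for all `h ∈ SL₂(ℤ)`, where at `τ` the conjugates of `Δ_N` are pairwise distinct and
`(E_4^χ ∣ g_b)(τ) ≠ 0` for `χ ∈ s`, `b < μ`, then `c_{χ,i} = 0` for `χ ∈ s`. [folklore] -/
theorem charExplicitForm_conj_indep (s : Finset (DirichletCharacter ℂ N))
    (c : DirichletCharacter ℂ N → Fin (gamma0Index N) → ℂ) (τ : ℍ)
    (hinj : Function.Injective fun x : SL(2, ℤ) ⧸ Gamma0 N ↦ conjDeltaDil N x τ)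
    (hE : ∀ χ ∈ s, ∀ b : Fin (gamma0Index N), (eisensteinChar N 4 χ ∣[(4 : ℤ)] gamma0Rep N b) τ ≠ 0)
    (hrel : ∀ h : SL(2, ℤ),
      ∑ χ ∈ s, ∑ i, c χ i * (charExplicitForm N χ i ∣[charExplicitWeight N] h) τ = 0) :
    ∀ χ ∈ s, ∀ i, c χ i = 0 := by
  classical
  -- Step 1: isolate each character by orthogonality, for `β` with `(E_4^χ₀ ∣ β)(τ) ≠ 0`
  have hiso : ∀ χ₀ ∈ s, ∀ β : SL(2, ℤ), (eisensteinChar N 4 χ₀ ∣[(4 : ℤ)] β) τ ≠ 0 →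
      ∑ i, c χ₀ i * (explicitForm N (gamma0Index N) i ∣[12 * ((gamma0Index N : ℤ) - 1)] β) τ = 0 := by
    intro χ₀ hχ₀ β hβ
    have htw : ∀ d : ZMod N, ∑ χ ∈ s, χ d * ((eisensteinChar N 4 χ ∣[(4 : ℤ)] β) τ *
        ∑ i, c χ i * (explicitForm N (gamma0Index N) i ∣[12 * ((gamma0Index N : ℤ) - 1)] β) τ) = 0 := by
      intro d
      by_cases hd : IsUnit d
      · obtain ⟨σ, hσ, hσd⟩ := exists_mem_gamma0_apply_one_one_eq (N := N) hd.unit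
        have h := hrel (σ * β)
        rw [← h]
        refine Finset.sum_congr rfl fun χ _ ↦ ?_
        rw [Finset.mul_sum, Finset.mul_sum]
        refine Finset.sum_congr rfl fun i _ ↦ ?_
        rw [charExplicitForm_slash_mul χ i hσ β, hσd, IsUnit.unit_spec]
        simp only [Pi.smul_apply, Pi.mul_apply, smul_eq_mul]
        ring
      · exact Finset.sum_eq_zero fun χ _ ↦ by rw [MulChar.map_nonunit χ hd, zero_mul]
    have hsum : ∑ d : ZMod N, χ₀⁻¹ d * ∑ χ ∈ s, χ d * ((eisensteinChar N 4 χ ∣[(4 : ℤ)] β) τ *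
        ∑ i, c χ i * (explicitForm N (gamma0Index N) i ∣[12 * ((gamma0Index N : ℤ) - 1)] β) τ) = 0 := by
      simp [htw]
    have hswap : ∑ d : ZMod N, χ₀⁻¹ d * ∑ χ ∈ s, χ d * ((eisensteinChar N 4 χ ∣[(4 : ℤ)] β) τ *
        ∑ i, c χ i * (explicitForm N (gamma0Index N) i ∣[12 * ((gamma0Index N : ℤ) - 1)] β) τ) =
        ∑ χ ∈ s, (∑ d : ZMod N, (χ₀⁻¹ * χ) d) * ((eisensteinChar N 4 χ ∣[(4 : ℤ)] β) τ *
          ∑ i, c χ i * (explicitForm N (gamma0Index N) i ∣[12 * ((gamma0Index N : ℤ) - 1)] β) τ) := by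
      calc _ = ∑ d : ZMod N, ∑ χ ∈ s, χ₀⁻¹ d * (χ d * ((eisensteinChar N 4 χ ∣[(4 : ℤ)] β) τ *
            ∑ i, c χ i * (explicitForm N (gamma0Index N) i ∣[12 * ((gamma0Index N : ℤ) - 1)] β) τ)) := by
            refine Finset.sum_congr rfl fun d _ ↦ ?_
            rw [Finset.mul_sum]
        _ = ∑ χ ∈ s, ∑ d : ZMod N, χ₀⁻¹ d * (χ d * ((eisensteinChar N 4 χ ∣[(4 : ℤ)] β) τ *
            ∑ i, c χ i * (explicitForm N (gamma0Index N) i ∣[12 * ((gamma0Index N : ℤ) - 1)] β) τ)) :=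
            Finset.sum_comm
        _ = _ := by
            refine Finset.sum_congr rfl fun χ _ ↦ ?_
            rw [Finset.sum_mul]
            refine Finset.sum_congr rfl fun d _ ↦ ?_
            rw [MulChar.mul_apply]
            ring
    rw [hswap, Finset.sum_eq_single χ₀ ?_ (fun h ↦ absurd hχ₀ h)] at hsum
    · rw [inv_mul_cancel, MulChar.sum_one_eq_card_units] at hsum
      have hcard : ((Fintype.card (ZMod N)ˣ : ℕ) : ℂ) ≠ 0 := by exact_mod_cast Fintype.card_ne_zero
      have h1 := (mul_eq_zero.mp hsum).resolve_left hcard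
      exact (mul_eq_zero.mp h1).resolve_left hβ
    · intro χ _ hne
      rw [MulChar.sum_eq_zero_of_ne_one, zero_mul]
      intro h1
      apply hne
      calc χ = χ₀ * (χ₀⁻¹ * χ) := by rw [← mul_assoc, mul_inv_cancel, one_mul]
        _ = χ₀ := by rw [h1, mul_one]
  -- Step 2: the `Γ₀(N)`-conjugate matrix of the explicit forms is invertible at `τ`
  intro χ₀ hχ₀ i₀
  have hΔ : ModularForm.discriminant τ ≠ 0 := discriminant_ne_zero τ
  let f : Fin (gamma0Index N) → ℂ := fun b ↦ conjDeltaDil N ((cosetEquiv N).symm b) τ / ModularForm.discriminant τ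
  have hf : Function.Injective f := by
    intro b b' h
    have := hinj ((div_left_inj' hΔ).mp h :
      conjDeltaDil N ((cosetEquiv N).symm b) τ = conjDeltaDil N ((cosetEquiv N).symm b') τ)
    exact (cosetEquiv N).symm.injective this
  have key : (fun i ↦ c χ₀ i) = 0 := by
    refine Matrix.eq_zero_of_forall_index_sum_mul_pow_eq_zero hf fun b ↦ ?_
    have h0 := hiso χ₀ hχ₀ (gamma0Rep N b) (hE χ₀ hχ₀ b)
    have h0' : ModularForm.discriminant τ ^ ((gamma0Index N) - 1) * ∑ i, c χ₀ i * f b ^ (i : ℕ) = 0 := by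
      rw [Finset.mul_sum, ← h0]
      refine Finset.sum_congr rfl fun i _ ↦ ?_
      rw [explicitForm_slash_gamma0Rep_apply]
      ring
    exact (mul_eq_zero.mp h0').resolve_left (pow_ne_zero _ hΔ)
  exact congrFun key i₀

/-- **A good point exists**: some `τ ∈ ℍ` at which the `μ` conjugates of `Δ_N` are pairwise distinct
and the finitely many conjugates `E_4^χ ∣ g_b` (`χ ∈ s` even, `b < μ`) do not vanish (finitely many
non-zero holomorphic functions on `ℍ`; `E_4^χ ∣ g ≢ 0` since `E_4^χ ≢ 0`). [folklore] -/
theorem exists_good_point (s : Finset (DirichletCharacter ℂ N)) (hs : ∀ χ ∈ s, χ.Even) :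
    ∃ τ : ℍ, Function.Injective (fun x : SL(2, ℤ) ⧸ Gamma0 N ↦ conjDeltaDil N x τ) ∧
      ∀ χ ∈ s, ∀ b : Fin (gamma0Index N), (eisensteinChar N 4 χ ∣[(4 : ℤ)] gamma0Rep N b) τ ≠ 0 := by
  classical
  -- the distinctness function `W`
  obtain ⟨W, hW⟩ : ∃ W : ℍ → ℂ, W = ∏ q ∈ (Finset.univ : Finset ((SL(2, ℤ) ⧸ Gamma0 N) ×
      (SL(2, ℤ) ⧸ Gamma0 N))).filter (fun q ↦ q.1 ≠ q.2), (conjDeltaDil N q.1 - conjDeltaDil N q.2) :=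
    ⟨_, rfl⟩
  have hWprop : W ≠ 0 ∧ MDiff W := by
    rw [hW]
    exact prod_ne_zero_of_mdifferentiable
      ((Finset.univ : Finset ((SL(2, ℤ) ⧸ Gamma0 N) × (SL(2, ℤ) ⧸ Gamma0 N))).filter (fun q ↦ q.1 ≠ q.2))
      (f := fun q ↦ conjDeltaDil N q.1 - conjDeltaDil N q.2)
      (fun q _ ↦ (mdifferentiable_conjDeltaDil N q.1).sub (mdifferentiable_conjDeltaDil N q.2))
      (fun q hq ↦ by
        rw [Finset.mem_filter] at hq
        exact sub_ne_zero.mpr fun h ↦ hq.2 (conjDeltaDil_injective N h))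
  -- the Eisenstein conjugates
  have hEne : ∀ χ ∈ s, ∀ β : SL(2, ℤ), eisensteinChar N 4 χ ∣[(4 : ℤ)] β ≠ 0 := by
    intro χ hχ β h
    apply eisensteinChar_ne_zero (N := N) (χ := χ) (k := 4) (by norm_num) (by rw [hs χ hχ]; norm_num)
    have := congrArg (fun f : ℍ → ℂ ↦ f ∣[(4 : ℤ)] (β⁻¹ : SL(2, ℤ))) h
    simp only [← SlashAction.slash_mul, mul_inv_cancel, SlashAction.slash_one,
      SlashAction.zero_slash] at this
    exact this
  obtain ⟨P, hP⟩ : ∃ P : ℍ → ℂ, P = ∏ q ∈ (Finset.univ : Finset (s × Fin (gamma0Index N))),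
      eisensteinChar N 4 q.1 ∣[(4 : ℤ)] gamma0Rep N q.2 := ⟨_, rfl⟩
  have hPprop : P ≠ 0 ∧ MDiff P := by
    rw [hP]
    exact prod_ne_zero_of_mdifferentiable (Finset.univ : Finset (s × Fin (gamma0Index N)))
      (f := fun q ↦ eisensteinChar N 4 q.1 ∣[(4 : ℤ)] gamma0Rep N q.2)
      (fun q _ ↦ by
        rw [ModularForm.SL_slash]
        exact (mdifferentiable_eisensteinChar (N := N) (χ := (q.1 : DirichletCharacter ℂ N))
          (by norm_num)).slash _ _)
      (fun q _ ↦ hEne q.1 q.1.2 _)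
  -- a common non-zero of `W` and `P`
  have hWP : W * P ≠ 0 := fun h ↦
    hPprop.1 (eq_zero_of_mul_eq_zero_of_mdifferentiable hWprop.2 hWprop.1 hPprop.2.continuous h)
  obtain ⟨τ, hτ⟩ : ∃ τ, (W * P) τ ≠ 0 := Function.ne_iff.mp hWP
  rw [Pi.mul_apply, mul_ne_zero_iff] at hτ
  have hinj : Function.Injective (fun x : SL(2, ℤ) ⧸ Gamma0 N ↦ conjDeltaDil N x τ) := by
    intro x y hxy
    by_contra hne
    apply hτ.1
    rw [hW, Finset.prod_apply]
    exact Finset.prod_eq_zero (Finset.mem_filter.mpr ⟨Finset.mem_univ (x, y), hne⟩) (by simp [hxy])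
  have hEτ : ∀ χ ∈ s, ∀ b : Fin (gamma0Index N),
      (eisensteinChar N 4 χ ∣[(4 : ℤ)] gamma0Rep N b) τ ≠ 0 := by
    intro χ hχ b hb
    apply hτ.2
    rw [hP, Finset.prod_apply]
    exact Finset.prod_eq_zero (Finset.mem_univ ((⟨χ, hχ⟩ : s), b)) hb
  exact ⟨τ, hinj, hEτ⟩

end ConjIndep

/-! ### The rank input for `±Γ₁(N)` and its consequences -/

section RankInputGamma1

variable (N : ℕ) [NeZero N]

open scoped Classical in
/-- `#EvenCharIndex = [SL₂(ℤ) : ±Γ₁(N)]` (`N ≥ 3`): both are `φ(N)μ/2`. [folklore] -/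
theorem card_evenCharIndex_eq_index (hN : 3 ≤ N) :
    Fintype.card (EvenCharIndex N) = (Gamma1pm N).index := by
  have h1 := two_mul_card_evenCharIndex (N := N) hN
  have h2 := two_mul_index_gamma1pm N hN
  omega

open scoped Classical in
/-- The reindexing `Fin [SL₂(ℤ) : ±Γ₁(N)] ≃ EvenCharIndex N` (`N ≥ 3`). [folklore] -/
def finEquivEvenCharIndex (hN : 3 ≤ N) : Fin (Gamma1pm N).index ≃ EvenCharIndex N :=
  (Fintype.equivFinOfCardEq (card_evenCharIndex_eq_index N hN)).symm

/-- The weight `w₀ = 4 + 12(μ-1)` is even and `≥ 0`. [folklore] -/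
theorem charExplicitWeight_even_nonneg : Even (charExplicitWeight N) ∧ 0 ≤ charExplicitWeight N := by
  have hμ : 1 ≤ gamma0Index N := by
    have h : (Gamma0 N).index = gamma0Index N := index_gamma0_eq_gamma0Index_holds N
    rw [← h]
    exact Nat.one_le_iff_ne_zero.mpr Subgroup.index_ne_zero_of_finite
  refine ⟨⟨2 + 6 * ((gamma0Index N : ℤ) - 1), by unfold charExplicitWeight; ring⟩, ?_⟩
  unfold charExplicitWeight
  have : (1 : ℤ) ≤ gamma0Index N := by exact_mod_cast hμ
  linarith

/-- `G_{χ,i} ∈ M_{w₀}(±Γ₁(N))` (even weight). [folklore] -/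
theorem charExplicitForm_mem_levelSpace_gamma1pm (χ : DirichletCharacter ℂ N) (i : Fin (gamma0Index N)) :
    charExplicitForm N χ i ∈ Level.levelSpace (Gamma1pm N) (charExplicitWeight N) := by
  have h : charExplicitForm N χ i ∈ formSpace (Gamma1 N) (charExplicitWeight N) :=
    charExplicitForm_mem N χ i
  rw [← formSpace_gamma1pm_eq_of_even N (charExplicitWeight_even_nonneg N).1] at h
  exact h

open scoped Classical in
/-- **The rank input for `±Γ₁(N)`, `N ≥ 3`**: the forms `G_{χ,i} = E_4^χ Δ^{μ-1-i}Δ_N^i` (`χ` even),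
reindexed by `Fin [SL₂(ℤ) : ±Γ₁(N)]`, with conjugate matrix over `SL₂(ℤ)/±Γ₁(N)` invertible at a
good point (`charExplicitForm_conj_indep`: a kernel vector of the conjugate matrix is a relation on
all cosets, i.e. for all `h ∈ SL₂(ℤ)`, `Level.cosetSlash_mk`). [cite: Gannon2014, Thm. 3.4(a), §3.5] -/
def rankInputGamma1pm (hN : 3 ≤ N) : Level.RankInput (Gamma1pm N) where
  wt₀ := charExplicitWeight N
  G := fun j ↦ charExplicitForm N (finEquivEvenCharIndex N hN j).1.1 (finEquivEvenCharIndex N hN j).2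
  wt₀_nonneg := (charExplicitWeight_even_nonneg N).2
  mem := fun j ↦ charExplicitForm_mem_levelSpace_gamma1pm N _ _
  det_ne_zero := by
    set e := finEquivEvenCharIndex N hN with he
    set s : Finset (DirichletCharacter ℂ N) := Finset.univ.filter fun χ ↦ χ.Even with hs_def
    have hs : ∀ χ ∈ s, χ.Even := fun χ hχ ↦ (Finset.mem_filter.mp hχ).2
    obtain ⟨τ, hinj, hE⟩ := exists_good_point s hs
    refine ⟨τ, ?_⟩
    set M : Matrix (Fin (Gamma1pm N).index) (Fin (Gamma1pm N).index) ℂ :=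
      Matrix.of fun a i ↦ Level.cosetSlash (Gamma1pm N) (charExplicitWeight N)
        (charExplicitForm N (e i).1.1 (e i).2) ((Level.cosetEquiv (Gamma1pm N)).symm a) τ with hM
    -- the columns of `M` are linearly independent
    suffices hli : LinearIndependent ℂ (fun i a ↦ M a i) by
      have hU : IsUnit M := Matrix.linearIndependent_cols_iff_isUnit.mp hli
      exact ((Matrix.isUnit_iff_isUnit_det M).mp hU).ne_zero
    rw [Fintype.linearIndependent_iff]
    intro c hc j
    -- extend `c` to a coefficient table on `DirichletCharacter × Fin μ`
    let C : DirichletCharacter ℂ N → Fin (gamma0Index N) → ℂ :=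
      fun χ i ↦ if h : χ.Even then c (e.symm (⟨χ, h⟩, i)) else 0
    have hinvG : ∀ i, ∀ γ ∈ Gamma1pm N, charExplicitForm N (e i).1.1 (e i).2 ∣[charExplicitWeight N]
        ((γ : SL(2, ℤ)) : GL (Fin 2) ℝ) = charExplicitForm N (e i).1.1 (e i).2 :=
      fun i ↦ Level.slash_eq_of_mem_levelSpace (charExplicitForm_mem_levelSpace_gamma1pm N _ _)
    -- the relation for every `h ∈ SL₂(ℤ)`
    have hrel : ∀ h : SL(2, ℤ),
        ∑ χ ∈ s, ∑ i, C χ i * (charExplicitForm N χ i ∣[charExplicitWeight N] h) τ = 0 := by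
      intro h
      -- the relation at the coset of `h⁻¹`
      have hcoset := congrFun hc (Level.cosetEquiv (Gamma1pm N) ((h⁻¹ : SL(2, ℤ)) : SL(2, ℤ) ⧸ Gamma1pm N))
      simp only [Finset.sum_apply, Pi.smul_apply, smul_eq_mul, Pi.zero_apply, hM, Matrix.of_apply,
        Equiv.symm_apply_apply] at hcoset
      rw [← hcoset]
      -- reindex the double sum by `e`
      have hre : ∑ χ ∈ s, ∑ i, C χ i * (charExplicitForm N χ i ∣[charExplicitWeight N] h) τ =
          ∑ j, c j * (charExplicitForm N (e j).1.1 (e j).2 ∣[charExplicitWeight N] h) τ := by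
        rw [← Finset.sum_coe_sort s, ← Fintype.sum_prod_type']
        let e' : s × Fin (gamma0Index N) ≃ EvenCharIndex N :=
          (Equiv.subtypeEquiv (Equiv.refl _) (fun χ ↦ by simp [hs_def])).prodCongr (Equiv.refl _)
        rw [← Equiv.sum_comp (e.trans e'.symm)]
        refine Finset.sum_congr rfl fun j _ ↦ ?_
        have h1 : ((e.trans e'.symm) j).1.1 = (e j).1.1 := rfl
        have h2 : ((e.trans e'.symm) j).2 = (e j).2 := rfl
        rw [h1, h2]
        congr 1
        simp only [C, dif_pos (e j).1.2]
        congr 1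
        exact e.symm_apply_apply j
      rw [hre]
      refine Finset.sum_congr rfl fun i _ ↦ ?_
      rw [Level.cosetSlash_mk (hinvG i), inv_inv, ModularForm.SL_slash]
    have hC := charExplicitForm_conj_indep s C τ hinj hE hrel
    have := hC (e j).1.1 (Finset.mem_filter.mpr ⟨Finset.mem_univ _, (e j).1.2⟩) (e j).2
    simp only [C, dif_pos (e j).1.2] at this
    rwa [show (⟨(e j).1.1, (e j).1.2⟩ : {χ : DirichletCharacter ℂ N // χ.Even}) = (e j).1 from rfl,
      Prod.mk.eta, Equiv.symm_apply_apply] at this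

/-- **`M(±Γ₁(N))` has a level-one basis indexed by `Fin [SL₂(ℤ) : ±Γ₁(N)]`, of even weights `≥ 0`**
(`N ≥ 3`): the even-weight forms on `Γ₁(N)` form a free `ℂ[E₄, E₆]`-module of rank `φ(N)μ/2`
(Gannon's Thm. 3.4(a) for `ρ = Ind_{±Γ₁(N)}^{SL₂(ℤ)} 1`). [cite: Gannon2014, Thm. 3.4(a)] -/
theorem exists_isLevelBasis_gamma1pm (hN : 3 ≤ N) :
    ∃ (wt : Fin (Gamma1pm N).index → ℤ) (F : Fin (Gamma1pm N).index → ℍ → ℂ),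
      Level.IsLevelBasis (Gamma1pm N) wt F ∧ ∀ i, 0 ≤ wt i ∧ Even (wt i) :=
  Level.exists_isLevelBasis_card_eq (Gamma1pm N) (neg_one_mem_gamma1pm N) (rankInputGamma1pm N hN)

omit [NeZero N] in
/-- `ν₂(±Γ₁(N)) = 0` for `N ≥ 3` (in the notation of `ModularFormsLevelRank`). [folklore] -/
theorem nu₂Level_gamma1pm (hN : 3 ≤ N) : Level.nu₂Level (Gamma1pm N) = 0 :=
  card_fixed_S_gamma1pm N hN

omit [NeZero N] in
/-- `ν₃(±Γ₁(N)) = 0` for `N ≥ 4`. [folklore] -/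
theorem nu₃Level_gamma1pm (hN : 4 ≤ N) : Level.nu₃Level (Gamma1pm N) = 0 :=
  card_fixed_ST_gamma1pm N hN

variable {N}

/-- **Gannon's constraints for `±Γ₁(N)`, `N ≥ 4` (no elliptic points)**: for a level-one basis of
`M(±Γ₁(N))` of even weights `≥ 0` indexed by `Fin [SL₂(ℤ):±Γ₁(N)]`,
`2#{4 ∣ k_j} = [SL₂(ℤ):±Γ₁(N)] = 2#{4 ∤ k_j}` and
`3#{6 ∣ k_j} = 3#{k_j ≡ 2 (6)} = 3#{k_j ≡ 4 (6)} = [SL₂(ℤ):±Γ₁(N)]` — the generator weights are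
equidistributed modulo `4` and modulo `6`. [cite: Gannon2014, Thm. 3.4(b)] -/
theorem card_constraints_gamma1pm (hN : 4 ≤ N) {wt : Fin (Gamma1pm N).index → ℤ}
    {F : Fin (Gamma1pm N).index → ℍ → ℂ} (hb : Level.IsLevelBasis (Gamma1pm N) wt F)
    (hwt : ∀ j, 0 ≤ wt j ∧ Even (wt j)) :
    2 * (Finset.univ.filter fun j ↦ (4 : ℤ) ∣ wt j).card = (Gamma1pm N).index ∧
    2 * (Finset.univ.filter fun j ↦ ¬ (4 : ℤ) ∣ wt j).card = (Gamma1pm N).index ∧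
    3 * (Finset.univ.filter fun j ↦ (6 : ℤ) ∣ wt j).card = (Gamma1pm N).index ∧
    3 * (Finset.univ.filter fun j ↦ wt j % 6 = 2).card = (Gamma1pm N).index ∧
    3 * (Finset.univ.filter fun j ↦ wt j % 6 = 4).card = (Gamma1pm N).index := by
  have hN3 : 3 ≤ N := by omega
  have R := rankInputGamma1pm N hN3
  obtain ⟨h4, h4'⟩ := Level.two_mul_card_four_dvd hb R (neg_one_mem_gamma1pm N) hwt
  obtain ⟨h6, h62, h64⟩ := Level.three_mul_card_six_dvd hb R (neg_one_mem_gamma1pm N) hwt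
  rw [nu₂Level_gamma1pm N hN3] at h4 h4'
  rw [nu₃Level_gamma1pm N hN] at h6 h62 h64
  omega

end RankInputGamma1

end Literature.NumberTheory.EllipticCurves.ModularForms
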